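import Literature.Probability.Percolation.ComplementPatternCounts
import HarnessLib

/-!
# 3-point complementary-pair inequality CPI₂ when the port is adjacent to a terminal

Crux `stmt-CriticalPhenomena-4575`, route `PercNearOneGluingNoHeavy`, fibre line (lead memo g135 §7e;
facecert memos gen 23 §6(a), gen 24b §1).  For a finite multigraph `(V, α, ends)`, terminals `s, b`
and port `c`, the 3-point complementary-pair counts are
`M = #{z : s ↮ b in z, c ↔ {s,b} in z}` and `L = #{z : s ↮ b in z, c ↔ {s,b} in z̄}`
(`z̄ = fun a => !z a` the complementary configuration), and CPI₂ is the inequality `L ≤ 2 M`.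

This file proves CPI₂ whenever some edge label `a₀` joins the port `c` to a terminal
(`ends a₀ = s(c, s)` or `ends a₀ = s(c, b)`, not a loop): the map `z ↦ z[a₀ ↦ open]` is an
injection from the "bad" configurations `{s ↮ b, c ↮ {s,b} in z}` into the "good" ones
`{s ↮ b, c ↔ {s,b} in z}` (opening the edge `c–t` attaches `c` to the cluster of the terminal `t`
and cannot join `s` to `b`, because `c` was separated from both), and `L ≤ #bad + M ≤ 2 M`
(`threePoint_cpi_two_of_port_adj`).  This is the base case of the contraction induction for the
3-point CPI₂ (memo gen 24b §0(1)).  No definitions; statements use the vocabulary of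
`Literature/Probability/Percolation/ComplementPatternCounts.lean` (`labelledOpen`, `openGraph`) and
match `…Theorems/PercNearOneGluingNoHeavyLowerTailThreePointCPISigma.lean`.
-/

namespace Summit.CriticalPhenomena.PercolationContinuityZ3.Theorems.ThreePointCPIAdjacentPort

open Finset Literature.Probability.Percolation

variable {V α : Type*}

/-- **Walks across one extra edge.** If every edge of `G` is an edge of `D` or the edge `{c, t}`,
then for every `G`-walk from `x` to `w`, in `D` the endpoint `w` is reachable from `x`, from `t`
or from `c` (follow the walk after its last use of the extra edge). [folklore] -/
theorem reachable_or_of_walk {G D : SimpleGraph V} {c t : V}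
    (hGD : ∀ x y, G.Adj x y → D.Adj x y ∨ s(x, y) = s(c, t)) :
    ∀ {x w : V} (_ : G.Walk x w), D.Reachable x w ∨ D.Reachable t w ∨ D.Reachable c w := by
  intro x w p
  induction p with
  | nil => exact Or.inl (SimpleGraph.Reachable.refl _)
  | @cons x y w' hxy p ih =>
    rcases ih with hy | hrest
    · rcases hGD x y hxy with hD | he
      · exact Or.inl (hD.reachable.trans hy)
      · rcases Sym2.eq_iff.mp he with ⟨-, rfl⟩ | ⟨-, rfl⟩
        · exact Or.inr (Or.inl hy)
        · exact Or.inr (Or.inr hy)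
    · exact Or.inr hrest

/-- Opening one more label `a₀` adds at most the edge `ends a₀` to the open graph. [folklore] -/
theorem adj_update_true (ends : α → Sym2 V) (z : α → Bool) (a₀ : α) [DecidableEq α] (x y : V)
    (h : (openGraph (labelledOpen ends (Function.update z a₀ true))).Adj x y) :
    (openGraph (labelledOpen ends z)).Adj x y ∨ s(x, y) = ends a₀ := by
  rw [openGraph_adj] at h
  obtain ⟨⟨a, ha, hae⟩, hne⟩ := h
  by_cases haa : a = a₀
  · subst haa; exact Or.inr hae.symm
  · refine Or.inl ((openGraph_adj _ _ _).mpr ⟨⟨a, ?_, hae⟩, hne⟩)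
    simpa [Function.update_of_ne haa] using ha

/-- Opening labels only adds open connections. [folklore] -/
theorem reachable_update_true (ends : α → Sym2 V) (z : α → Bool) (a₀ : α) [DecidableEq α]
    {u v : V} (h : (openGraph (labelledOpen ends z)).Reachable u v) :
    (openGraph (labelledOpen ends (Function.update z a₀ true))).Reachable u v := by
  obtain ⟨p⟩ := h
  refine reachable_of_walk_of_labels ends z _ p fun a ha _ => ?_
  by_cases haa : a = a₀
  · subst haa; simp
  · simpa [Function.update_of_ne haa] using ha

open Classical in
/-- **The injection.** If the label `a₀` joins the port `c` to the terminal `t ∈ {s, b}` (no loop),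
then `z ↦ z[a₀ ↦ open]` maps `{s ↮ b, c ↮ s, c ↮ b in z}` injectively into
`{s ↮ b in z, c ↔ s ∨ c ↔ b in z}`; hence the former set is at most as large as the latter.
[facecert gen 24b §1] -/
theorem card_bad_le_card_good [Fintype α] [DecidableEq α] (ends : α → Sym2 V) (s b c t : V)
    (ht : t = s ∨ t = b) (a₀ : α) (h₀ : ends a₀ = s(c, t)) (hct : c ≠ t) :
    (univ.filter fun z : α → Bool =>
        ¬ (openGraph (labelledOpen ends z)).Reachable s b ∧
        ¬ ((openGraph (labelledOpen ends z)).Reachable c s ∨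
          (openGraph (labelledOpen ends z)).Reachable c b)).card ≤
    (univ.filter fun z : α → Bool =>
        ¬ (openGraph (labelledOpen ends z)).Reachable s b ∧
        ((openGraph (labelledOpen ends z)).Reachable c s ∨
          (openGraph (labelledOpen ends z)).Reachable c b)).card := by
  classical
  -- the new edge is open after the update
  have hadj : ∀ z : α → Bool,
      (openGraph (labelledOpen ends (Function.update z a₀ true))).Adj c t := fun z =>
    (openGraph_adj _ _ _).mpr ⟨⟨a₀, by simp, h₀⟩, hct⟩
  -- a bad configuration has `a₀` closed
  have hclosed : ∀ z : α → Bool,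
      ¬ ((openGraph (labelledOpen ends z)).Reachable c s ∨
        (openGraph (labelledOpen ends z)).Reachable c b) → z a₀ = false := by
    intro z hz
    by_contra hne
    have hza : z a₀ = true := by simpa using hne
    have hdiag : ¬ (ends a₀).IsDiag := by rw [h₀]; simpa using hct
    have hct' : (openGraph (labelledOpen ends z)).Reachable c t :=
      SimpleGraph.Adj.reachable ((openGraph_adj _ _ _).mpr ⟨⟨a₀, hza, h₀⟩, hct⟩)
    rcases ht with rfl | rfl
    · exact hz (Or.inl hct')
    · exact hz (Or.inr hct')
  refine Finset.card_le_card_of_injOn (fun z => Function.update z a₀ true) ?_ ?_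
  · intro z hz
    simp only [coe_filter, mem_univ, true_and, Set.mem_setOf_eq] at hz ⊢
    obtain ⟨hF, hX⟩ := hz
    refine ⟨?_, ?_⟩
    · -- s ↮ b after opening a₀
      rintro ⟨p⟩
      have key := reachable_or_of_walk (G := openGraph (labelledOpen ends (Function.update z a₀ true)))
        (D := openGraph (labelledOpen ends z)) (c := c) (t := t)
        (fun x y hxy => by
          rcases adj_update_true ends z a₀ x y hxy with h | h
          · exact Or.inl h
          · exact Or.inr (h.trans h₀)) p
      rcases ht with rfl | rfl
      · -- t = s: walk from s to b
        rcases key with h | h | h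
        · exact hF h
        · exact hF h
        · exact hX (Or.inr h)
      · -- t = b: use the reversed walk from b to s
        have key' := reachable_or_of_walk
          (G := openGraph (labelledOpen ends (Function.update z a₀ true)))
          (D := openGraph (labelledOpen ends z)) (c := c) (t := t)
          (fun x y hxy => by
            rcases adj_update_true ends z a₀ x y hxy with h | h
            · exact Or.inl h
            · exact Or.inr (h.trans h₀)) p.reverse
        rcases key' with h | h | h
        · exact hF h.symm
        · exact hF h.symm
        · exact hX (Or.inl h)
    · -- c ↔ t after opening a₀
      rcases ht with rfl | rfl
      · exact Or.inl (hadj z).reachable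
      · exact Or.inr (hadj z).reachable
  · intro z₁ hz₁ z₂ hz₂ heq
    simp only [coe_filter, mem_univ, true_and, Set.mem_setOf_eq] at hz₁ hz₂
    have h1 := hclosed z₁ hz₁.2
    have h2 := hclosed z₂ hz₂.2
    funext a
    by_cases haa : a = a₀
    · subst haa; rw [h1, h2]
    · have := congrArg (fun f => f a) heq
      simpa [Function.update_of_ne haa] using this

open Classical in
/-- **3-point CPI₂ for a port adjacent to a terminal.** If some edge label joins the port `c` to
`s` or to `b` (not a loop), then
`#{z : s ↮ b in z, c ↔ {s,b} in z̄} ≤ 2 · #{z : s ↮ b in z, c ↔ {s,b} in z}`: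
split the left-hand set by `c ↔ {s,b} in z`; the part with it is contained in the right-hand set,
the part without it is bad and injects into the right-hand set by `card_bad_le_card_good`.
[facecert gen 24b §1; gen 23 §6(a)] -/
theorem threePoint_cpi_two_of_port_adj [Fintype α] [DecidableEq α] (ends : α → Sym2 V)
    (s b c t : V) (ht : t = s ∨ t = b) (a₀ : α) (h₀ : ends a₀ = s(c, t)) (hct : c ≠ t) :
    (univ.filter fun z : α → Bool =>
        ¬ (openGraph (labelledOpen ends z)).Reachable s b ∧
        ((openGraph (labelledOpen ends fun a => !z a)).Reachable c s ∨
          (openGraph (labelledOpen ends fun a => !z a)).Reachable c b)).card ≤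
      2 * (univ.filter fun z : α → Bool =>
        ¬ (openGraph (labelledOpen ends z)).Reachable s b ∧
        ((openGraph (labelledOpen ends z)).Reachable c s ∨
          (openGraph (labelledOpen ends z)).Reachable c b)).card := by
  classical
  -- split the left-hand set by `c ↔ {s,b} in z`
  have hsplit := card_filter_add_card_filter_not
    (s := univ.filter fun z : α → Bool =>
        ¬ (openGraph (labelledOpen ends z)).Reachable s b ∧
        ((openGraph (labelledOpen ends fun a => !z a)).Reachable c s ∨
          (openGraph (labelledOpen ends fun a => !z a)).Reachable c b))
    (fun z => (openGraph (labelledOpen ends z)).Reachable c s ∨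
      (openGraph (labelledOpen ends z)).Reachable c b)
  rw [filter_filter, filter_filter] at hsplit
  -- the part with `c ↔ {s,b} in z` lies in the right-hand set
  have h1 : (univ.filter fun z : α → Bool =>
        (¬ (openGraph (labelledOpen ends z)).Reachable s b ∧
        ((openGraph (labelledOpen ends fun a => !z a)).Reachable c s ∨
          (openGraph (labelledOpen ends fun a => !z a)).Reachable c b)) ∧
        ((openGraph (labelledOpen ends z)).Reachable c s ∨
          (openGraph (labelledOpen ends z)).Reachable c b)).card ≤
      (univ.filter fun z : α → Bool =>
        ¬ (openGraph (labelledOpen ends z)).Reachable s b ∧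
        ((openGraph (labelledOpen ends z)).Reachable c s ∨
          (openGraph (labelledOpen ends z)).Reachable c b)).card := by
    apply card_le_card
    intro z; simp only [mem_filter, mem_univ, true_and]; tauto
  -- the part without it is bad
  have h2 : (univ.filter fun z : α → Bool =>
        (¬ (openGraph (labelledOpen ends z)).Reachable s b ∧
        ((openGraph (labelledOpen ends fun a => !z a)).Reachable c s ∨
          (openGraph (labelledOpen ends fun a => !z a)).Reachable c b)) ∧
        ¬ ((openGraph (labelledOpen ends z)).Reachable c s ∨
          (openGraph (labelledOpen ends z)).Reachable c b)).card ≤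
      (univ.filter fun z : α → Bool =>
        ¬ (openGraph (labelledOpen ends z)).Reachable s b ∧
        ¬ ((openGraph (labelledOpen ends z)).Reachable c s ∨
          (openGraph (labelledOpen ends z)).Reachable c b)).card := by
    apply card_le_card
    intro z; simp only [mem_filter, mem_univ, true_and]; tauto
  have h3 := card_bad_le_card_good ends s b c t ht a₀ h₀ hct
  omega

end Summit.CriticalPhenomena.PercolationContinuityZ3.Theorems.ThreePointCPIAdjacentPort
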